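import Literature.AlgebraicGeometry.Motives.FrolicherBigradedTriple
import Literature.AlgebraicGeometry.Motives.DeRhamComparisonProofs
import HarnessLib

/-!
# The Frölicher inequality for compact complex manifolds: reduction to named facts

Proof architecture for the named facts
`Literature.AlgebraicGeometry.Motives.finrank_complexDeRham_le_sum_hodgeNumber`
(`dim_ℂ H^k_dR(M; ℂ) ≤ ∑_{p+q=k} h^{p,q}(M)`) and
`Literature.AlgebraicGeometry.Motives.bettiNumber_le_sum_hodgeNumber` (`b_k ≤ ∑ h^{p,q}`, the
Frölicher inequality, hodge.S18) of `DeRhamComparison`, following C. Voisin, *Hodge Theory and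
Complex Algebraic Geometry I* (2002), §8.3.3, proof of Thm. 8.28 and Rem. 8.29, pp. 204–205;
Frölicher (1955), §2.

The spectral-sequence algebra is the fully proved
`Literature.Algebra.Homology.BigradedTriple.finite_and_finrank_cohomology_le_sum_of_equiv`
(`Literature/Algebra/Homology/FilteredComplexFinrank`), and its instantiation on the de Rham
complex with the `(p,q)`-type projections is `FrolicherBigradedTriple`. Here we build the
triples — `A^{k₀}(M; ℂ) -d→ A^{k₀+1} -d→ A^{k₀+2}` in degree `k₀ + 1`, and `A⁰ -0→ A⁰ -d→ A¹` in
degree `0` (there are no exact `0`-forms: `cexactSmoothForms E M 0 = ⊥`,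
`dolbeaultExactForms E M p 0 = ⊥`) — and conclude

* `finite_and_finrank_complexDeRham_le_sum_hodgeNumber`: `H^k_dR(M; ℂ)` is finite-dimensional and
  `dim_ℂ H^k_dR(M; ℂ) ≤ ∑_{p+q=k} h^{p,q}(M)` for a compact Hausdorff complex manifold;
* `finrank_complexDeRham_le_sum_hodgeNumber_of`: the named fact
  `finrank_complexDeRham_le_sum_hodgeNumber E M`;
* `bettiNumber_le_sum_hodgeNumber_of_facts`: the Frölicher inequality
  `bettiNumber_le_sum_hodgeNumber E M`, additionally from `dim_ℂ H^k_dR(M; ℂ) = b_k(M; ℂ)`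
  (`finrank_complexDeRham_eq_bettiNumber`, via `bettiNumber_le_sum_hodgeNumber_of`);
* `bettiNumber_le_sum_hodgeNumber_of_facts_of_exists_complexDeRhamIsoFamily`: the same with
  de Rham's theorem in its canonical tree form `exists_complexDeRhamIsoFamily E` (universal
  coefficients over `ℂ` being proved, `DeRhamComparisonProofs`);

all **conditional** (D-0014) on the named facts threaded as hypotheses: `inChart_mextDeriv`,
`mextDeriv_smul_complex`, `isSmoothForm_typeComponent`, `sum_antidiagonal_typeComponent`,
`typeComponent_typeComponent`, `isOfType_iff_typeComponent_eq_self`,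
`mextDeriv_eq_dolbeault_add_dolbeaultBar`, `IsOfType.dolbeault_eq`, `IsOfType.dolbeaultBar_eq`
(type decomposition and `d = ∂ + ∂̄`), and Cartan–Serre finiteness `finite_dolbeaultCohomology`
(without which `hodgeNumber = Module.finrank` is junk and the inequality fails formally). So the
unproved leaves of `bettiNumber_le_sum_hodgeNumber` are exactly: these nine pointwise /
chart-calculus facts, Cartan–Serre, and de Rham's theorem; the Frölicher spectral-sequence
argument itself is proved. The linear maps of the triples come from existence lemmas and are
consumed only through their defining equations, so no definitions are introduced.

## References

* A. Frölicher, *Relations between the cohomology groups of Dolbeault and topological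
  invariants*, Proc. Nat. Acad. Sci. USA 41 (1955), 641–644, §2 (`FrolicherPNAS1955`).
* C. Voisin, *Hodge Theory and Complex Algebraic Geometry I* (2002), §8.3.3 (proof of Thm. 8.28,
  Rem. 8.29), pp. 204–205 (`VoisinHodgeI2002`).
-/

noncomputable section

open scoped Manifold ContDiff
open Module Finset
open Literature.Geometry.Kaehler Literature.NumberTheory.Transcendental Literature.Algebra.Homology

namespace Literature.AlgebraicGeometry.Motives

section FrolicherDegrees

variable {E : Type*} [NormedAddCommGroup E] [NormedSpace ℂ E]
  {M : Type*} [TopologicalSpace M] [ChartedSpace E M]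

/-! ### The two shapes of degree -/

/-- **Frölicher inequality in degree `0`** (conditional): `H⁰_dR(M; ℂ)` is finite-dimensional
and `dim_ℂ H⁰_dR(M; ℂ) ≤ h^{0,0}(M)`, via the bigraded triple `A⁰ -0→ A⁰ -d→ A¹`.
[cite: VoisinHodgeI2002, §8.3.3, proof of Thm. 8.28 and Rem. 8.29] -/
theorem finite_and_finrank_complexDeRham_le_sum_hodgeNumber_zero [FiniteDimensional ℂ E]
    [IsManifold 𝓘(ℂ, E) ω M] [IsManifold 𝓘(ℝ, E) ∞ M] [CompactSpace M] [T2Space M]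
    (hic : inChart_mextDeriv 𝓘(ℝ, E) M ℂ)
    (hsc : ∀ {k : ℕ}, mextDeriv_smul_complex (E := E) (M := M) (k := k))
    (hst : ∀ {k : ℕ}, isSmoothForm_typeComponent (E := E) (M := M) (k := k))
    (hsum : ∀ {k : ℕ}, sum_antidiagonal_typeComponent (E := E) (M := M) (k := k))
    (htt : ∀ {k : ℕ}, typeComponent_typeComponent (E := E) (M := M) (k := k))
    (hio : ∀ {k : ℕ}, isOfType_iff_typeComponent_eq_self (E := E) (M := M) (k := k))
    (hdd : ∀ {k : ℕ}, mextDeriv_eq_dolbeault_add_dolbeaultBar (E := E) (M := M) (k := k))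
    (hdel : ∀ {k : ℕ}, IsOfType.dolbeault_eq (E := E) (M := M) (k := k))
    (hdelbar : ∀ {k : ℕ}, IsOfType.dolbeaultBar_eq (E := E) (M := M) (k := k))
    (hCS : finite_dolbeaultCohomology (E := E) (M := M)) :
    FiniteDimensional ℂ (complexDeRhamCohomology E M 0) ∧
      finrank ℂ (complexDeRhamCohomology E M 0) ≤
        ∑ pq ∈ antidiagonal 0, hodgeNumber E M pq.1 pq.2 := by
  obtain ⟨π₁, hπ₁⟩ := exists_linearMap_typeComponent (E := E) (M := M) (j := 0) hst
  obtain ⟨π₂, hπ₂⟩ := exists_linearMap_typeComponent (E := E) (M := M) (j := 0 + 1) hst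
  obtain ⟨d₁, hd₁⟩ := exists_linearMap_mextDeriv (E := E) (M := M) (j := 0) hic hsc
  have hsm : ∀ x : ↥(csmoothForms E M 0), IsSmoothForm (x : MForm 𝓘(ℝ, E) M ℂ 0) := fun x ↦
    (mem_csmoothForms_iff _).1 x.2
  let B : BigradedTriple ℂ ↥(csmoothForms E M 0) ↥(csmoothForms E M 0)
      ↥(csmoothForms E M (0 + 1)) :=
    { d₀ := 0
      d₁ := d₁
      π₀ := fun r ↦ π₁ r (0 - r)
      π₁ := fun r ↦ π₁ r (0 - r)
      π₂ := fun r ↦ π₂ r (0 + 1 - r)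
      N := 0
      d₁_d₀ := fun x ↦ by rw [LinearMap.zero_apply, map_zero]
      sum_π₁ := fun x ↦ Subtype.ext (by
        rw [Submodule.coe_sum]
        simp only [hπ₁]
        exact sum_range_typeComponent hsum _)
      π₀_π₀_of_ne := fun hr y ↦ Subtype.ext (by
        rw [hπ₁, hπ₁, htt, if_neg (fun h ↦ hr h.1.symm)]
        rfl)
      π₁_π₁_self := fun r x ↦ Subtype.ext (by rw [hπ₁, hπ₁, htt, if_pos ⟨rfl, rfl⟩])
      π₁_d₀_π₀ := fun _ _ y ↦ by rw [LinearMap.zero_apply, map_zero]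
      π₂_d₁_π₁ := fun hr hr' x ↦ Subtype.ext (by
        rw [hπ₂, hd₁, hπ₁]
        exact typeComponent_mextDeriv_typeComponent_of_ne hst htt hio hdd hdel hdelbar hr hr' _
          (hsm x)) }
  refine finite_and_finrank_complexDeRham_le_of_bigradedTriple B rfl hd₁ (fun z ↦ ?_)
    (fun p _ ↦ hCS p (0 - p)) (fun p hp ↦ ?_)
  · change (z : MForm 𝓘(ℝ, E) M ℂ 0) ∈ (⊥ : Submodule ℂ (MForm 𝓘(ℝ, E) M ℂ 0)) ↔
      z ∈ LinearMap.range (0 : ↥(csmoothForms E M 0) →ₗ[ℂ] ↥(csmoothForms E M 0))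
    rw [LinearMap.range_zero, Submodule.mem_bot, Submodule.mem_bot]
    exact ⟨fun h ↦ Subtype.ext h, fun h ↦ congrArg Subtype.val h⟩
  · obtain rfl : p = 0 := Nat.le_zero.1 hp
    exact nonempty_pureCohomology_equiv_dolbeaultCohomology_zero (p := 0) B
      (fun x ↦ hπ₁ 0 (0 - 0) x) (fun y ↦ hπ₂ 0 (0 + 1 - 0) y) hd₁
      (fun y ↦ by
        change π₁ 0 (0 - 0) ((0 : ↥(csmoothForms E M 0) →ₗ[ℂ] ↥(csmoothForms E M 0)) _) = 0
        rw [LinearMap.zero_apply, map_zero])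
      hio hdelbar

/-- **Frölicher inequality in degree `k₀ + 1`** (conditional): `H^{k₀+1}_dR(M; ℂ)` is
finite-dimensional and `dim_ℂ H^{k₀+1}_dR(M; ℂ) ≤ ∑_{p+q=k₀+1} h^{p,q}(M)`, via the bigraded
triple `A^{k₀} -d→ A^{k₀+1} -d→ A^{k₀+2}`.
[cite: VoisinHodgeI2002, §8.3.3, proof of Thm. 8.28 and Rem. 8.29] -/
theorem finite_and_finrank_complexDeRham_le_sum_hodgeNumber_succ [FiniteDimensional ℂ E]
    [IsManifold 𝓘(ℂ, E) ω M] [IsManifold 𝓘(ℝ, E) ∞ M] [CompactSpace M] [T2Space M]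
    (hic : inChart_mextDeriv 𝓘(ℝ, E) M ℂ)
    (hsc : ∀ {k : ℕ}, mextDeriv_smul_complex (E := E) (M := M) (k := k))
    (hst : ∀ {k : ℕ}, isSmoothForm_typeComponent (E := E) (M := M) (k := k))
    (hsum : ∀ {k : ℕ}, sum_antidiagonal_typeComponent (E := E) (M := M) (k := k))
    (htt : ∀ {k : ℕ}, typeComponent_typeComponent (E := E) (M := M) (k := k))
    (hio : ∀ {k : ℕ}, isOfType_iff_typeComponent_eq_self (E := E) (M := M) (k := k))
    (hdd : ∀ {k : ℕ}, mextDeriv_eq_dolbeault_add_dolbeaultBar (E := E) (M := M) (k := k))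
    (hdel : ∀ {k : ℕ}, IsOfType.dolbeault_eq (E := E) (M := M) (k := k))
    (hdelbar : ∀ {k : ℕ}, IsOfType.dolbeaultBar_eq (E := E) (M := M) (k := k))
    (hCS : finite_dolbeaultCohomology (E := E) (M := M)) (k₀ : ℕ) :
    FiniteDimensional ℂ (complexDeRhamCohomology E M (k₀ + 1)) ∧
      finrank ℂ (complexDeRhamCohomology E M (k₀ + 1)) ≤
        ∑ pq ∈ antidiagonal (k₀ + 1), hodgeNumber E M pq.1 pq.2 := by
  obtain ⟨π₀, hπ₀⟩ := exists_linearMap_typeComponent (E := E) (M := M) (j := k₀) hst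
  obtain ⟨π₁, hπ₁⟩ := exists_linearMap_typeComponent (E := E) (M := M) (j := k₀ + 1) hst
  obtain ⟨π₂, hπ₂⟩ := exists_linearMap_typeComponent (E := E) (M := M) (j := k₀ + 1 + 1) hst
  obtain ⟨d₀, hd₀⟩ := exists_linearMap_mextDeriv (E := E) (M := M) (j := k₀) hic hsc
  obtain ⟨d₁, hd₁⟩ := exists_linearMap_mextDeriv (E := E) (M := M) (j := k₀ + 1) hic hsc
  have hsm : ∀ {j : ℕ} (x : ↥(csmoothForms E M j)), IsSmoothForm (x : MForm 𝓘(ℝ, E) M ℂ j) :=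
    fun x ↦ (mem_csmoothForms_iff _).1 x.2
  let B : BigradedTriple ℂ ↥(csmoothForms E M k₀) ↥(csmoothForms E M (k₀ + 1))
      ↥(csmoothForms E M (k₀ + 1 + 1)) :=
    { d₀ := d₀
      d₁ := d₁
      π₀ := fun r ↦ π₀ r (k₀ - r)
      π₁ := fun r ↦ π₁ r (k₀ + 1 - r)
      π₂ := fun r ↦ π₂ r (k₀ + 1 + 1 - r)
      N := k₀ + 1
      d₁_d₀ := fun x ↦ Subtype.ext (by
        rw [hd₁, hd₀]
        exact mextDeriv_mextDeriv hic (hsm x))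
      sum_π₁ := fun x ↦ Subtype.ext (by
        rw [Submodule.coe_sum]
        simp only [hπ₁]
        exact sum_range_typeComponent hsum _)
      π₀_π₀_of_ne := fun hr y ↦ Subtype.ext (by
        rw [hπ₀, hπ₀, htt, if_neg (fun h ↦ hr h.1.symm)]
        rfl)
      π₁_π₁_self := fun r x ↦ Subtype.ext (by rw [hπ₁, hπ₁, htt, if_pos ⟨rfl, rfl⟩])
      π₁_d₀_π₀ := fun hr hr' y ↦ Subtype.ext (by
        rw [hπ₁, hd₀, hπ₀]
        exact typeComponent_mextDeriv_typeComponent_of_ne hst htt hio hdd hdel hdelbar hr hr' _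
          (hsm y))
      π₂_d₁_π₁ := fun hr hr' x ↦ Subtype.ext (by
        rw [hπ₂, hd₁, hπ₁]
        exact typeComponent_mextDeriv_typeComponent_of_ne hst htt hio hdd hdel hdelbar hr hr' _
          (hsm x)) }
  -- the exact `(k₀+1)`-forms are the image of `d₀`
  have hspan : cexactSmoothForms E M (k₀ + 1) =
      (LinearMap.range d₀).map (csmoothForms E M (k₀ + 1)).subtype := by
    change Submodule.span ℂ (mextDeriv ''
      (csmoothForms E M k₀ : Set (MForm 𝓘(ℝ, E) M ℂ k₀))) = _
    refine Submodule.span_eq_of_le _ ?_ ?_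
    · rintro _ ⟨y, hy, rfl⟩
      exact ⟨d₀ ⟨y, hy⟩, LinearMap.mem_range_self d₀ _, hd₀ _⟩
    · rintro _ ⟨x, hx, rfl⟩
      obtain ⟨y, rfl⟩ := LinearMap.mem_range.1 hx
      exact Submodule.subset_span ⟨y, y.2, (hd₀ y).symm⟩
  refine finite_and_finrank_complexDeRham_le_of_bigradedTriple B rfl hd₁ (fun z ↦ ?_)
    (fun p _ ↦ hCS p (k₀ + 1 - p)) (fun p hp ↦ ?_)
  · rw [hspan, Submodule.mem_map]
    constructor
    · rintro ⟨z', hz', hzz'⟩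
      rwa [← Subtype.ext hzz']
    · exact fun hz ↦ ⟨z, hz, rfl⟩
  · rcases hp.lt_or_eq with hlt | rfl
    · -- `p ≤ k₀`: write `k₀ = p + q`
      obtain ⟨q, rfl⟩ : ∃ q, k₀ = p + q := ⟨k₀ - p, by omega⟩
      have e₁ : p + q + 1 - p = q + 1 := by omega
      have e₂ : p + q + 1 + 1 - p = q + 1 + 1 := by omega
      rw [e₁]
      exact nonempty_pureCohomology_equiv_dolbeaultCohomology_succ (p := p) (q := q) B
        (fun y ↦ by
          change ((π₀ p (p + q - p) y : ↥(csmoothForms E M (p + q))) :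
            MForm 𝓘(ℝ, E) M ℂ (p + q)) = _
          rw [hπ₀, Nat.add_sub_cancel_left])
        hd₀
        (fun x ↦ by
          change ((π₁ p (p + q + 1 - p) x : ↥(csmoothForms E M (p + q + 1))) :
            MForm 𝓘(ℝ, E) M ℂ (p + q + 1)) = _
          rw [hπ₁, e₁])
        (fun z ↦ by
          change ((π₂ p (p + q + 1 + 1 - p) z : ↥(csmoothForms E M (p + q + 1 + 1))) :
            MForm 𝓘(ℝ, E) M ℂ (p + q + 1 + 1)) = _
          rw [hπ₂, e₂])
        hd₁ hst htt hio hio hdelbar hdelbar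
    · -- `p = k₀ + 1`
      rw [Nat.sub_self]
      have e₂ : k₀ + 1 + 1 - (k₀ + 1) = 1 := by omega
      refine nonempty_pureCohomology_equiv_dolbeaultCohomology_zero (p := k₀ + 1) B
        (fun x ↦ by
          change ((π₁ (k₀ + 1) (k₀ + 1 - (k₀ + 1)) x : ↥(csmoothForms E M (k₀ + 1))) :
            MForm 𝓘(ℝ, E) M ℂ (k₀ + 1)) = _
          rw [hπ₁, Nat.sub_self])
        (fun y ↦ by
          change ((π₂ (k₀ + 1) (k₀ + 1 + 1 - (k₀ + 1)) y : ↥(csmoothForms E M (k₀ + 1 + 1))) :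
            MForm 𝓘(ℝ, E) M ℂ (k₀ + 1 + 1)) = _
          rw [hπ₂, e₂])
        hd₁ (fun y ↦ ?_) hio hdelbar
      have hy : π₀ (k₀ + 1) (k₀ - (k₀ + 1)) y = 0 := Subtype.ext (by
        rw [hπ₀]
        exact MForm.typeComponent_of_ne (by omega) _)
      change π₁ (k₀ + 1) (k₀ + 1 - (k₀ + 1)) (d₀ (π₀ (k₀ + 1) (k₀ - (k₀ + 1)) y)) = 0
      rw [hy, map_zero, map_zero]

/-- **`H^k_dR(M; ℂ)` is finite-dimensional with `dim_ℂ H^k_dR(M; ℂ) ≤ ∑_{p+q=k} h^{p,q}(M)`** for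
a compact complex manifold `M` (conditional on the named facts listed in the module
docstring): the numerical shadow of the Frölicher spectral sequence
`E₁^{p,q} = H^{p,q}_{∂̄}(M) ⟹ H^{p+q}_dR(M; ℂ)`. Voisin (2002), §8.3.3, proof of Thm. 8.28 and
Rem. 8.29, pp. 204–205; Frölicher (1955), §2.
[cite: VoisinHodgeI2002, §8.3.3, proof of Thm. 8.28 and Rem. 8.29] -/
theorem finite_and_finrank_complexDeRham_le_sum_hodgeNumber [FiniteDimensional ℂ E]
    [IsManifold 𝓘(ℂ, E) ω M] [IsManifold 𝓘(ℝ, E) ∞ M] [CompactSpace M] [T2Space M]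
    (hic : inChart_mextDeriv 𝓘(ℝ, E) M ℂ)
    (hsc : ∀ {k : ℕ}, mextDeriv_smul_complex (E := E) (M := M) (k := k))
    (hst : ∀ {k : ℕ}, isSmoothForm_typeComponent (E := E) (M := M) (k := k))
    (hsum : ∀ {k : ℕ}, sum_antidiagonal_typeComponent (E := E) (M := M) (k := k))
    (htt : ∀ {k : ℕ}, typeComponent_typeComponent (E := E) (M := M) (k := k))
    (hio : ∀ {k : ℕ}, isOfType_iff_typeComponent_eq_self (E := E) (M := M) (k := k))
    (hdd : ∀ {k : ℕ}, mextDeriv_eq_dolbeault_add_dolbeaultBar (E := E) (M := M) (k := k))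
    (hdel : ∀ {k : ℕ}, IsOfType.dolbeault_eq (E := E) (M := M) (k := k))
    (hdelbar : ∀ {k : ℕ}, IsOfType.dolbeaultBar_eq (E := E) (M := M) (k := k))
    (hCS : finite_dolbeaultCohomology (E := E) (M := M)) (k : ℕ) :
    FiniteDimensional ℂ (complexDeRhamCohomology E M k) ∧
      finrank ℂ (complexDeRhamCohomology E M k) ≤
        ∑ pq ∈ antidiagonal k, hodgeNumber E M pq.1 pq.2 := by
  cases k with
  | zero =>
    exact finite_and_finrank_complexDeRham_le_sum_hodgeNumber_zero hic hsc hst hsum htt hio hdd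
      hdel hdelbar hCS
  | succ k₀ =>
    exact finite_and_finrank_complexDeRham_le_sum_hodgeNumber_succ hic hsc hst hsum htt hio hdd
      hdel hdelbar hCS k₀

end FrolicherDegrees

/-! ### The named facts of `DeRhamComparison` -/

section Facts

variable (E : Type) [NormedAddCommGroup E] [NormedSpace ℂ E]
  (M : Type) [TopologicalSpace M] [ChartedSpace E M]
  [IsManifold 𝓘(ℂ, E) ω M] [IsManifold 𝓘(ℝ, E) ∞ M]

/-- **The analytic core of the Frölicher inequality**, `finrank_complexDeRham_le_sum_hodgeNumber`
(`dim_ℂ H^k_dR(M; ℂ) ≤ ∑_{p+q=k} h^{p,q}(M)` for compact Hausdorff complex `M`), derived from the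
named facts listed in the module docstring (type decomposition, `d = ∂ + ∂̄`, `d² = 0`,
Cartan–Serre finiteness); the spectral-sequence algebra is proved
(`Literature.Algebra.Homology.BigradedTriple.finite_and_finrank_cohomology_le_sum_of_equiv`).
Voisin (2002), §8.3.3, proof of Thm. 8.28 and Rem. 8.29, pp. 204–205.
[cite: VoisinHodgeI2002, §8.3.3, proof of Thm. 8.28 and Rem. 8.29] -/
theorem finrank_complexDeRham_le_sum_hodgeNumber_of
    (hic : inChart_mextDeriv 𝓘(ℝ, E) M ℂ)
    (hsc : ∀ {k : ℕ}, mextDeriv_smul_complex (E := E) (M := M) (k := k))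
    (hst : ∀ {k : ℕ}, isSmoothForm_typeComponent (E := E) (M := M) (k := k))
    (hsum : ∀ {k : ℕ}, sum_antidiagonal_typeComponent (E := E) (M := M) (k := k))
    (htt : ∀ {k : ℕ}, typeComponent_typeComponent (E := E) (M := M) (k := k))
    (hio : ∀ {k : ℕ}, isOfType_iff_typeComponent_eq_self (E := E) (M := M) (k := k))
    (hdd : ∀ {k : ℕ}, mextDeriv_eq_dolbeault_add_dolbeaultBar (E := E) (M := M) (k := k))
    (hdel : ∀ {k : ℕ}, IsOfType.dolbeault_eq (E := E) (M := M) (k := k))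
    (hdelbar : ∀ {k : ℕ}, IsOfType.dolbeaultBar_eq (E := E) (M := M) (k := k))
    (hCS : finite_dolbeaultCohomology (E := E) (M := M)) :
    finrank_complexDeRham_le_sum_hodgeNumber E M := by
  intro _ _ _ _ _ k
  exact (finite_and_finrank_complexDeRham_le_sum_hodgeNumber hic hsc hst hsum htt hio hdd hdel
    hdelbar hCS k).2

/-- **The Frölicher inequality** `bettiNumber_le_sum_hodgeNumber` (`b_k(M; ℂ) ≤ ∑_{p+q=k} h^{p,q}(M)`
for compact complex `M`, Frölicher 1955), derived from the named facts listed in the module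
docstring together with de Rham's theorem `dim_ℂ H^k_dR(M; ℂ) = b_k(M; ℂ)`
(`finrank_complexDeRham_eq_bettiNumber`), via `bettiNumber_le_sum_hodgeNumber_of`.
Voisin (2002), §8.3.3, Rem. 8.29; Frölicher (1955), §2.
[cite: VoisinHodgeI2002, §8.3.3, proof of Thm. 8.28 and Rem. 8.29] -/
theorem bettiNumber_le_sum_hodgeNumber_of_facts [CompactSpace M] [T2Space M]
    (hic : inChart_mextDeriv 𝓘(ℝ, E) M ℂ)
    (hsc : ∀ {k : ℕ}, mextDeriv_smul_complex (E := E) (M := M) (k := k))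
    (hst : ∀ {k : ℕ}, isSmoothForm_typeComponent (E := E) (M := M) (k := k))
    (hsum : ∀ {k : ℕ}, sum_antidiagonal_typeComponent (E := E) (M := M) (k := k))
    (htt : ∀ {k : ℕ}, typeComponent_typeComponent (E := E) (M := M) (k := k))
    (hio : ∀ {k : ℕ}, isOfType_iff_typeComponent_eq_self (E := E) (M := M) (k := k))
    (hdd : ∀ {k : ℕ}, mextDeriv_eq_dolbeault_add_dolbeaultBar (E := E) (M := M) (k := k))
    (hdel : ∀ {k : ℕ}, IsOfType.dolbeault_eq (E := E) (M := M) (k := k))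
    (hdelbar : ∀ {k : ℕ}, IsOfType.dolbeaultBar_eq (E := E) (M := M) (k := k))
    (hCS : finite_dolbeaultCohomology (E := E) (M := M)) [FiniteDimensional ℂ E]
    (hdR : ∀ k, finrank_complexDeRham_eq_bettiNumber E M k) :
    bettiNumber_le_sum_hodgeNumber E M := by
  exact bettiNumber_le_sum_hodgeNumber_of E M
    (finrank_complexDeRham_le_sum_hodgeNumber_of E M hic hsc hst hsum htt hio hdd hdel hdelbar hCS)
    hdR

/-- **The Frölicher inequality from the named facts and de Rham's theorem in canonical form**:
the nine type-calculus facts, Cartan–Serre finiteness and the natural complex de Rham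
isomorphism family `exists_complexDeRhamIsoFamily E` (`H^k_dR(M; ℂ) ≃ₗ[ℂ] H^k(M; ℂ)`) imply
`bettiNumber_le_sum_hodgeNumber E M`; universal coefficients over `ℂ`
(`dim_ℂ H^k(M; ℂ) = b_k(M; ℂ)`) are proved
(`finrank_complexDeRham_eq_bettiNumber_of_exists_complexDeRhamIsoFamily`). Voisin (2002),
§8.3.3, Rem. 8.29; Frölicher (1955), §2. [cite: VoisinHodgeI2002, §8.3.3, proof of Thm. 8.28 and Rem. 8.29] -/
theorem bettiNumber_le_sum_hodgeNumber_of_facts_of_exists_complexDeRhamIsoFamily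
    (hic : inChart_mextDeriv 𝓘(ℝ, E) M ℂ)
    (hsc : ∀ {k : ℕ}, mextDeriv_smul_complex (E := E) (M := M) (k := k))
    (hst : ∀ {k : ℕ}, isSmoothForm_typeComponent (E := E) (M := M) (k := k))
    (hsum : ∀ {k : ℕ}, sum_antidiagonal_typeComponent (E := E) (M := M) (k := k))
    (htt : ∀ {k : ℕ}, typeComponent_typeComponent (E := E) (M := M) (k := k))
    (hio : ∀ {k : ℕ}, isOfType_iff_typeComponent_eq_self (E := E) (M := M) (k := k))
    (hdd : ∀ {k : ℕ}, mextDeriv_eq_dolbeault_add_dolbeaultBar (E := E) (M := M) (k := k))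
    (hdel : ∀ {k : ℕ}, IsOfType.dolbeault_eq (E := E) (M := M) (k := k))
    (hdelbar : ∀ {k : ℕ}, IsOfType.dolbeaultBar_eq (E := E) (M := M) (k := k))
    (hCS : finite_dolbeaultCohomology (E := E) (M := M)) [FiniteDimensional ℂ E]
    (hdR : exists_complexDeRhamIsoFamily E) :
    bettiNumber_le_sum_hodgeNumber E M := by
  exact bettiNumber_le_sum_hodgeNumber_of_exists_complexDeRhamIsoFamily E M
    (finrank_complexDeRham_le_sum_hodgeNumber_of E M hic hsc hst hsum htt hio hdd hdel hdelbar hCS)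
    hdR

end Facts

end Literature.AlgebraicGeometry.Motives
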